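import Literature.NumberTheory.Automorphic.AutomorphicFormsEllipticAnnihilator
import Literature.NumberTheory.Automorphic.AutomorphicFormsGrowthFolland
import Literature.NumberTheory.Automorphic.StarFormallyRealTrace
import HarnessLib

/-!
# Borel–Jacquet 4.3 for a general regular datum, reduced to elliptic regularity
# (Folland 1995, Cor. (6.34) and Thm. (8.45))

Topic `NumberTheory/Automorphic`; the assembly of the "elliptic annihilator + fundamental
solution" line on the named fact `automorphicForms_isStableSubmodule 𝒟` of `AutomorphicForms`
(Borel–Jacquet 1979, 4.3: the space of automorphic forms of a regular automorphy datum over a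
finite-dimensional coefficient algebra is `(𝔤, K_∞) × G(𝔸_f)`-stable):

* `AutomorphicFormsEllipticAnnihilator` — every automorphic form `φ` is annihilated by a real
  monic polynomial in the sum of squares `L_B = ∑ᵢ Bᵢ Bᵢ` over a basis `B` of `𝔤` (Casimir
  element plus `2 ∑_𝔨 Yᵢ²`; Borel 1972, 3.15–3.16), given a positive star-trace on `A`;
* `StarFormallyRealTrace` — such a trace exists (the regular trace `Algebra.trace ℝ A`,
  `IsStarFormallyReal.exists_positive_starTrace`), `A` being star-formally real
  (`IsRegular.isStarFormallyReal`) with `ℝ`-linear involution;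
* `AutomorphicFormsGrowthFolland` — granted Folland (8.45) and (6.34), the annihilator makes every
  `X φ` of moderate growth (reproducing kernel in the exponential chart), whence 4.3 through
  `automorphicForms_isStableSubmodule_of_hasModerateGrowth_lieDeriv`.

Main statement: `automorphicForms_isStableSubmodule_of_folland` — **for a coefficient algebra with
`ℝ`-linear involution (`[StarModule ℝ A]`), the named fact `automorphicForms_isStableSubmodule 𝒟`
follows from the two named facts `Folland1995_thm845` and `Folland1995_cor634` of
`Literature.Analysis.Distribution.EllipticRegularity`** (and nothing else: Harish-Chandra's
convolution identity is not used).

On the hypothesis `[StarModule ℝ A]`: the fact `automorphicForms_isStableSubmodule` quantifies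
over an arbitrary `[StarRing A]`, and `AutomorphyDatum.IsRegular` does not force the involution
to be `ℝ`-linear (its field `hasCartanDecomposition` does not mention scalars), whereas the
source (Borel–Jacquet 1979, 4.1–4.3: `G_∞ = G(K ⊗ ℝ)`, `K_∞` a maximal compact subgroup) only
ever meets `A = K ⊗_ℚ ℝ ≅ ℝ^{r₁} × ℂ^{r₂}` with its standard (real-linear) involution; the sibling
facts of `AutomorphicForms` (`isAdmissible_automorphicRep`, …) carry `[StarModule ℝ A]`
explicitly. Every `𝔨`-argument of the tree (`RealMatrixGroup.compactLie`, `expK`,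
`IsArchSmooth.lieDeriv_mem_kTranslateSpan` consumers) needs it, and so does this file.

Everything here is proved; no definitions, no named facts (the Folland facts are hypotheses).

## References

* A. Borel, H. Jacquet, *Automorphic forms and automorphic representations*, Proc. Sympos. Pure
  Math. 33 (1979), Part 1, 4.3 [BorelJacquetCorvallis1979].
* G. B. Folland, *Introduction to Partial Differential Equations*, 2nd ed. (1995), Cor. (6.34),
  Thm. (8.45) [Folland2020].
* A. Borel, *Représentations de groupes localement compacts*, LNM 276 (1972), 3.15–3.18 [Borel1972].
-/

noncomputable section

open Literature.Analysis.Distribution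

namespace Literature.NumberTheory.Automorphic

-- Mathlib idiom (Mathlib/Algebra/Lie/OfAssociative.lean); needed to mention Lie subalgebras of matrix algebras
attribute [local instance 100] LieRing.ofAssociativeRing

variable {K : Type} [Field K] [NumberField K]
  {A : Type*} [NormedCommRing A] [NormedAlgebra ℝ A] [NormedAlgebra ℚ A] [CompleteSpace A]
  [StarRing A] {N : Type*} [Fintype N] [DecidableEq N]
  {𝒢 : AdelicGroupData K} {𝒟 : AutomorphyDatum 𝒢 A N}

omit [NormedAlgebra ℚ A] [CompleteSpace A] in
/-- An `ℝ`-linear involution on a finite-dimensional real normed algebra is continuous (the idiom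
of `RealMatrixGroupsProofs.isCompact_unitarySubgroupGL_holds`). [folklore] -/
theorem continuousStar_of_starModule [StarModule ℝ A] [FiniteDimensional ℝ A] : ContinuousStar A := by
  refine ⟨?_⟩
  let f : A →ₗ[ℝ] A :=
    { toFun := star
      map_add' := star_add
      map_smul' := fun r a => by simp only [star_smul, star_trivial, RingHom.id_apply] }
  exact f.continuous_of_finiteDimensional

/-- **The annihilators of automorphic forms, unconditionally** (regular datum, finite-dimensional
coefficients, `ℝ`-linear involution): every automorphic form `φ` satisfies `∑ⱼ rⱼ L_B^j φ = 0` for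
some basis `B` of `𝔤` and real `r` with `r_M = 1` — `IsAutomorphicForm.exists_elliptic_annihilator`
with the regular trace of `StarFormallyRealTrace` (`A` is star-formally real by regularity).
Borel 1972, 3.15–3.16; Borel–Jacquet 1979, 4.3 (ii). [cite: Borel1972, 3.15] -/
theorem IsAutomorphicForm.exists_annihilator [StarModule ℝ A] [FiniteDimensional ℝ A]
    (h𝒟 : 𝒟.IsRegular) {φ : 𝒢.Adelic → ℂ} (hφ : IsAutomorphicForm 𝒟 φ) :
    ∃ (d : ℕ) (B : Module.Basis (Fin d) ℝ 𝒟.arch.lie.toSubmodule) (M : ℕ) (r : ℕ → ℝ), r M = 1 ∧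
      ∀ x, ∑ j ∈ Finset.range (M + 1), (r j : ℂ) *
        ((fun ψ => ∑ i, iterLieDeriv 𝒟.ofArch [basisLie B i, basisLie B i] ψ)^[j] φ) x = 0 := by
  haveI : ContinuousStar A := continuousStar_of_starModule
  obtain ⟨tr, htr, hpos⟩ := h𝒟.isStarFormallyReal.exists_positive_starTrace
  obtain ⟨d, B, M, r, hrM, hann⟩ := hφ.exists_elliptic_annihilator h𝒟 htr hpos
  exact ⟨d, B, M, r, hrM, hann⟩

/-- **Borel–Jacquet 1979, 4.3 for every regular datum with `ℝ`-linear involution, granted Folland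
(8.45) and (6.34).** The named fact `automorphicForms_isStableSubmodule 𝒟` of `AutomorphicForms` —
the space of automorphic forms is a `(𝔤, K_∞) × G(𝔸_f)`-stable subspace — follows from the two
named facts `Folland1995_thm845` (local solvability of elliptic equations) and
`Folland1995_cor634` (elliptic operators are hypoelliptic) of `EllipticRegularity`: the group
part, the `𝔨`-part and the calculus are theorems of the tree (`AutomorphicFormsStable`,
`ArchimedeanEnvelopingActionRegular`), the elliptic annihilator is
`IsAutomorphicForm.exists_annihilator`, and the moderate growth of the `X φ` is
`HasModerateGrowth.lieDeriv_of_folland`. This replaces Harish-Chandra's convolution identity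
`φ = φ ∗ α` (Harish-Chandra 1966, §8, Thm. 1; Borel 1972, 3.18) of the printed proof.
[cite: BorelJacquetCorvallis1979, 4.3] -/
theorem automorphicForms_isStableSubmodule_of_folland [StarModule ℝ A]
    (h845 : Folland1995_thm845) (h634 : Folland1995_cor634) :
    automorphicForms_isStableSubmodule 𝒟 := by
  refine automorphicForms_isStableSubmodule_of_folland_of_annihilators h845 h634 ?_
  intro _ h𝒟 φ hφ
  exact hφ.exists_annihilator h𝒟

open scoped Classical in
open NumberField NumberField.mixedEmbedding IsDedekindDomain in
/-- **Borel–Jacquet 4.3 for the `GL_n` datum over a number field, granted Folland (8.45) and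
(6.34)**: the statement `automorphicForms_isStableSubmodule (AutomorphyDatum.gl n K hcpt)` — its
coefficient algebra `K ⊗_ℚ ℝ ≅ ℝ^{r₁} × ℂ^{r₂}` (`mixedSpace K`) carries the standard real-linear
involution. (The regularity of the `GL_n` datum is the hypothesis inside the statement.)
Borel–Jacquet 1979, 4.3. [cite: BorelJacquetCorvallis1979, 4.3] -/
theorem automorphicForms_isStableSubmodule_gl_of_folland {n : ℕ}
    (hcpt : isCompact_glFiniteIntegralLevel n K)
    (h845 : Folland1995_thm845) (h634 : Folland1995_cor634) :
    automorphicForms_isStableSubmodule (AutomorphyDatum.gl n K hcpt) :=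
  automorphicForms_isStableSubmodule_of_folland (𝒟 := AutomorphyDatum.gl n K hcpt) h845 h634

end Literature.NumberTheory.Automorphic
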